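import Summits.HodgeConjecture.HodgeConjecture.Theorems.LinearSystemTorelliLocalTubeSpanSp2Elementary
import Summits.HodgeConjecture.HodgeConjecture.Theorems.LinearSystemTorelliLocalTubeSpanPlaneCalculus
import Summits.HodgeConjecture.HodgeConjecture.Theorems.LinearSystemTorelliLocalTubeSpanUnimodularTransitivityLemmas

/-!
# Route LinearSystemTorelli — crux `LocalTubeSpan` (stmt-HodgeConjecture-2490): the `Sp♯₂` conditions form a group containing the level-2 moves

Helper file (`--supports stmt-HodgeConjecture-2490`, line `Sketch` of the crux chain, cycle 8,
continuation lead c7; stub `stub_sp2Closure`, worker K).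

For a form `B` on a `ℚ`-space `V` and `Δ ⊆ V` (`ℤΔ := Submodule.span ℤ Δ`), write `C(g)` for the
conjunction of the four hypotheses of `Janssen1983_thm2_5` on a unit `g` of `End V` (Schnell's
description of the level-2 congruence subgroup `Sp♯₂(ℤΔ)`):
(C1) `g` is an isometry of `B`; (C2) `g (ℤΔ) ⊆ ℤΔ`; (C3) `g⁻¹ (ℤΔ) ⊆ ℤΔ`;
(C4) for every functional `l` integral on `ℤΔ` there is `v ∈ ℤΔ` with `l (g x - x) = 2 B(v, x)` on
`ℤΔ`.  This file proves (the four conjuncts always spelled out):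

* `localTubeSpan_sp2Cond_mul` — `C(g) → C(h) → C(g h)` (`v_{gh} = h⁻¹ v_g + v_h`);
* `localTubeSpan_sp2Cond_inv` — `C(g) → C(g⁻¹)` (`v_{g⁻¹} = -g v_g`);
* `localTubeSpan_sp2Cond_one` — `C(1)` (`v = 0`);
* `localTubeSpan_sp2Cond_of_sqMove` — `C(g)` for a unit acting as a squared transvection `T_a²`,
  `v ↦ v - 2 B(v, a) a` with `a ∈ ℤΔ` (`v = l(a) a`), `B` alternating and integral on `Δ`;
* `localTubeSpan_sp2Cond_of_pairMove` — `C(g)` for a unit acting as a pair move `E_{e,f}²`,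
  `v ↦ v + 2 (B(v, e) f + B(v, f) e)` with `e, f ∈ ℤΔ`, `B(e, f) = 0` (`v = -(l(f) e + l(e) f)`).

These are the closure facts of the cycle-8 descent `g = h · (h⁻¹ g)` of a unit satisfying `C` to
the stabiliser of a unimodular pair.  No named facts; no `sorry`.
-/

-- `Summit.HodgeConjecture.HodgeConjecture.Theorems` is the mandated namespace (single-conjunct summit:
-- Sub = Summit), which `linter.dupNamespace` flags on every declaration; the lakefile turns the
-- linter off tree-wide (weak option), restated here so stand-alone elaboration is warning-free too.
set_option linter.dupNamespace false

noncomputable section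

open Literature.AlgebraicGeometry.HodgeTheory

namespace Summit.HodgeConjecture.HodgeConjecture.Theorems

/-! ### The four `Sp♯₂` conditions are closed under the group operations -/

section Sp2Closure

variable {V : Type} [AddCommGroup V] [Module ℚ V] (B : LinearMap.BilinForm ℚ V) (Δ : Set V)

/-- **Products.**  If the units `g`, `h` of `End V` are isometries of `B` preserving `ℤΔ` together
with their inverses and satisfy Schnell's displayed `Sp♯₂` condition (`l (g x - x) = 2 B(v_g, x)`,
`l (h x - x) = 2 B(v_h, x)` on `ℤΔ` for `l` integral on `ℤΔ`), then so does `g h`, with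
`v_{gh} = h⁻¹ v_g + v_h`: indeed `l (g h x - x) = l (g (h x) - h x) + l (h x - x)` and
`B(v_g, h x) = B(h⁻¹ v_g, x)` by the isometry `h`. [cite: Schnell2010, §7 Thm. 10] -/
theorem localTubeSpan_sp2Cond_mul (g h : (V →ₗ[ℚ] V)ˣ)
    (hg1 : ∀ x y : V, B ((g : V →ₗ[ℚ] V) x) ((g : V →ₗ[ℚ] V) y) = B x y)
    (hg2 : ∀ x ∈ Submodule.span ℤ Δ, (g : V →ₗ[ℚ] V) x ∈ Submodule.span ℤ Δ)
    (hg3 : ∀ x ∈ Submodule.span ℤ Δ, ((g⁻¹ : (V →ₗ[ℚ] V)ˣ) : V →ₗ[ℚ] V) x ∈ Submodule.span ℤ Δ)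
    (hg4 : ∀ l : V →ₗ[ℚ] ℚ, (∀ x ∈ Submodule.span ℤ Δ, ∃ z : ℤ, l x = z) →
      ∃ v ∈ Submodule.span ℤ Δ, ∀ x ∈ Submodule.span ℤ Δ, l ((g : V →ₗ[ℚ] V) x - x) = 2 * B v x)
    (hh1 : ∀ x y : V, B ((h : V →ₗ[ℚ] V) x) ((h : V →ₗ[ℚ] V) y) = B x y)
    (hh2 : ∀ x ∈ Submodule.span ℤ Δ, (h : V →ₗ[ℚ] V) x ∈ Submodule.span ℤ Δ)
    (hh3 : ∀ x ∈ Submodule.span ℤ Δ, ((h⁻¹ : (V →ₗ[ℚ] V)ˣ) : V →ₗ[ℚ] V) x ∈ Submodule.span ℤ Δ)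
    (hh4 : ∀ l : V →ₗ[ℚ] ℚ, (∀ x ∈ Submodule.span ℤ Δ, ∃ z : ℤ, l x = z) →
      ∃ v ∈ Submodule.span ℤ Δ, ∀ x ∈ Submodule.span ℤ Δ, l ((h : V →ₗ[ℚ] V) x - x) = 2 * B v x) :
    (∀ x y : V, B (((g * h : (V →ₗ[ℚ] V)ˣ) : V →ₗ[ℚ] V) x)
      (((g * h : (V →ₗ[ℚ] V)ˣ) : V →ₗ[ℚ] V) y) = B x y) ∧
    (∀ x ∈ Submodule.span ℤ Δ, ((g * h : (V →ₗ[ℚ] V)ˣ) : V →ₗ[ℚ] V) x ∈ Submodule.span ℤ Δ) ∧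
    (∀ x ∈ Submodule.span ℤ Δ,
      (((g * h)⁻¹ : (V →ₗ[ℚ] V)ˣ) : V →ₗ[ℚ] V) x ∈ Submodule.span ℤ Δ) ∧
    (∀ l : V →ₗ[ℚ] ℚ, (∀ x ∈ Submodule.span ℤ Δ, ∃ z : ℤ, l x = z) →
      ∃ v ∈ Submodule.span ℤ Δ, ∀ x ∈ Submodule.span ℤ Δ,
        l (((g * h : (V →ₗ[ℚ] V)ˣ) : V →ₗ[ℚ] V) x - x) = 2 * B v x) := by
  refine ⟨fun x y => ?_, fun x hx => ?_, fun x hx => ?_, fun l hl => ?_⟩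
  · -- isometry: composition of isometries
    rw [Units.val_mul, Module.End.mul_apply, Module.End.mul_apply, hg1, hh1]
  · -- `g h` preserves `ℤΔ`
    rw [Units.val_mul, Module.End.mul_apply]
    exact hg2 _ (hh2 x hx)
  · -- `(g h)⁻¹ = h⁻¹ g⁻¹` preserves `ℤΔ`
    rw [mul_inv_rev, Units.val_mul, Module.End.mul_apply]
    exact hh3 _ (hg3 x hx)
  · -- Schnell's displayed condition with `v = h⁻¹ v_g + v_h`
    obtain ⟨vg, hvg, hvgx⟩ := hg4 l hl
    obtain ⟨vh, hvh, hvhx⟩ := hh4 l hl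
    refine ⟨((h⁻¹ : (V →ₗ[ℚ] V)ˣ) : V →ₗ[ℚ] V) vg + vh, Submodule.add_mem _ (hh3 _ hvg) hvh,
      fun x hx => ?_⟩
    have e1 : ((g * h : (V →ₗ[ℚ] V)ˣ) : V →ₗ[ℚ] V) x - x =
        ((g : V →ₗ[ℚ] V) ((h : V →ₗ[ℚ] V) x) - (h : V →ₗ[ℚ] V) x) + ((h : V →ₗ[ℚ] V) x - x) := by
      rw [Units.val_mul, Module.End.mul_apply, sub_add_sub_cancel]
    have e2 : B (((h⁻¹ : (V →ₗ[ℚ] V)ˣ) : V →ₗ[ℚ] V) vg) x = B vg ((h : V →ₗ[ℚ] V) x) := by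
      rw [← hh1 (((h⁻¹ : (V →ₗ[ℚ] V)ˣ) : V →ₗ[ℚ] V) vg) x, localTubeSpan_units_apply_inv_apply]
    rw [e1, map_add, hvgx _ (hh2 x hx), hvhx x hx, map_add, LinearMap.add_apply, e2, mul_add]

/-- **Inverses.**  If the unit `g` of `End V` is an isometry of `B` preserving `ℤΔ` together with
its inverse and satisfies Schnell's displayed `Sp♯₂` condition `l (g x - x) = 2 B(v, x)` on `ℤΔ`,
then so does `g⁻¹`, with `v_{g⁻¹} = -g v`: indeed
`l (g⁻¹ x - x) = -l (g (g⁻¹ x) - g⁻¹ x) = -2 B(v, g⁻¹ x) = -2 B(g v, x)`.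
[cite: Schnell2010, §7 Thm. 10] -/
theorem localTubeSpan_sp2Cond_inv (g : (V →ₗ[ℚ] V)ˣ)
    (hg1 : ∀ x y : V, B ((g : V →ₗ[ℚ] V) x) ((g : V →ₗ[ℚ] V) y) = B x y)
    (hg2 : ∀ x ∈ Submodule.span ℤ Δ, (g : V →ₗ[ℚ] V) x ∈ Submodule.span ℤ Δ)
    (hg3 : ∀ x ∈ Submodule.span ℤ Δ, ((g⁻¹ : (V →ₗ[ℚ] V)ˣ) : V →ₗ[ℚ] V) x ∈ Submodule.span ℤ Δ)
    (hg4 : ∀ l : V →ₗ[ℚ] ℚ, (∀ x ∈ Submodule.span ℤ Δ, ∃ z : ℤ, l x = z) →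
      ∃ v ∈ Submodule.span ℤ Δ, ∀ x ∈ Submodule.span ℤ Δ, l ((g : V →ₗ[ℚ] V) x - x) = 2 * B v x) :
    (∀ x y : V, B (((g⁻¹ : (V →ₗ[ℚ] V)ˣ) : V →ₗ[ℚ] V) x)
      (((g⁻¹ : (V →ₗ[ℚ] V)ˣ) : V →ₗ[ℚ] V) y) = B x y) ∧
    (∀ x ∈ Submodule.span ℤ Δ, ((g⁻¹ : (V →ₗ[ℚ] V)ˣ) : V →ₗ[ℚ] V) x ∈ Submodule.span ℤ Δ) ∧
    (∀ x ∈ Submodule.span ℤ Δ,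
      ((g⁻¹⁻¹ : (V →ₗ[ℚ] V)ˣ) : V →ₗ[ℚ] V) x ∈ Submodule.span ℤ Δ) ∧
    (∀ l : V →ₗ[ℚ] ℚ, (∀ x ∈ Submodule.span ℤ Δ, ∃ z : ℤ, l x = z) →
      ∃ v ∈ Submodule.span ℤ Δ, ∀ x ∈ Submodule.span ℤ Δ,
        l (((g⁻¹ : (V →ₗ[ℚ] V)ˣ) : V →ₗ[ℚ] V) x - x) = 2 * B v x) := by
  refine ⟨fun x y => ?_, hg3, fun x hx => ?_, fun l hl => ?_⟩
  · -- isometry: apply `hg1` to `(g⁻¹ x, g⁻¹ y)`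
    have e := hg1 (((g⁻¹ : (V →ₗ[ℚ] V)ˣ) : V →ₗ[ℚ] V) x) (((g⁻¹ : (V →ₗ[ℚ] V)ˣ) : V →ₗ[ℚ] V) y)
    rw [localTubeSpan_units_apply_inv_apply, localTubeSpan_units_apply_inv_apply] at e
    exact e.symm
  · -- `g⁻¹⁻¹ = g` preserves `ℤΔ`
    rw [inv_inv]
    exact hg2 x hx
  · -- Schnell's displayed condition with `v = -g v_g`
    obtain ⟨v, hv, hvx⟩ := hg4 l hl
    refine ⟨-((g : V →ₗ[ℚ] V) v), Submodule.neg_mem _ (hg2 v hv), fun x hx => ?_⟩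
    have e1 : ((g⁻¹ : (V →ₗ[ℚ] V)ˣ) : V →ₗ[ℚ] V) x - x =
        -((g : V →ₗ[ℚ] V) (((g⁻¹ : (V →ₗ[ℚ] V)ˣ) : V →ₗ[ℚ] V) x) -
          ((g⁻¹ : (V →ₗ[ℚ] V)ˣ) : V →ₗ[ℚ] V) x) := by
      rw [localTubeSpan_units_apply_inv_apply, neg_sub]
    have e2 : B v (((g⁻¹ : (V →ₗ[ℚ] V)ˣ) : V →ₗ[ℚ] V) x) = B ((g : V →ₗ[ℚ] V) v) x := by
      rw [← hg1 v (((g⁻¹ : (V →ₗ[ℚ] V)ˣ) : V →ₗ[ℚ] V) x), localTubeSpan_units_apply_inv_apply]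
    rw [e1, map_neg, hvx _ (hg3 x hx), e2, map_neg, LinearMap.neg_apply, mul_neg]

/-- **Identity.**  The unit `1` of `End V` is an isometry of `B` preserving `ℤΔ` together with its
inverse and satisfies Schnell's displayed `Sp♯₂` condition with `v = 0`. [folklore] -/
theorem localTubeSpan_sp2Cond_one :
    (∀ x y : V, B (((1 : (V →ₗ[ℚ] V)ˣ) : V →ₗ[ℚ] V) x)
      (((1 : (V →ₗ[ℚ] V)ˣ) : V →ₗ[ℚ] V) y) = B x y) ∧
    (∀ x ∈ Submodule.span ℤ Δ, ((1 : (V →ₗ[ℚ] V)ˣ) : V →ₗ[ℚ] V) x ∈ Submodule.span ℤ Δ) ∧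
    (∀ x ∈ Submodule.span ℤ Δ,
      (((1 : (V →ₗ[ℚ] V)ˣ)⁻¹ : (V →ₗ[ℚ] V)ˣ) : V →ₗ[ℚ] V) x ∈ Submodule.span ℤ Δ) ∧
    (∀ l : V →ₗ[ℚ] ℚ, (∀ x ∈ Submodule.span ℤ Δ, ∃ z : ℤ, l x = z) →
      ∃ v ∈ Submodule.span ℤ Δ, ∀ x ∈ Submodule.span ℤ Δ,
        l (((1 : (V →ₗ[ℚ] V)ˣ) : V →ₗ[ℚ] V) x - x) = 2 * B v x) := by
  refine ⟨fun x y => ?_, fun x hx => ?_, fun x hx => ?_,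
    fun l _ => ⟨0, Submodule.zero_mem _, fun x _ => ?_⟩⟩
  · rw [Units.val_one, Module.End.one_apply, Module.End.one_apply]
  · rwa [Units.val_one, Module.End.one_apply]
  · rwa [inv_one, Units.val_one, Module.End.one_apply]
  · rw [Units.val_one, Module.End.one_apply, sub_self, map_zero, map_zero, LinearMap.zero_apply,
      mul_zero]

/-- **Squared transvections satisfy the four conditions.**  Let `B` be alternating and integral on
`Δ`, `a ∈ ℤΔ`, and let the unit `g` of `End V` act as `T_a² : v ↦ v - 2 B(v, a) a`.  Then `g` is an
isometry, `g` and `g⁻¹ : v ↦ v + 2 B(v, a) a` preserve `ℤΔ` (as `B(v, a) ∈ ℤ` for `v ∈ ℤΔ`), and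
`l (g x - x) = -2 B(x, a) l(a) = 2 B(l(a) a, x)` with `l(a) a ∈ ℤΔ` for `l` integral on `ℤΔ`.
[cite: Schnell2010, §7 Thm. 10] -/
theorem localTubeSpan_sp2Cond_of_sqMove (hB : B.IsAlt)
    (hint : ∀ δ ∈ Δ, ∀ δ' ∈ Δ, ∃ n : ℤ, B δ δ' = n)
    {a : V} (ha : a ∈ Submodule.span ℤ Δ) (g : (V →ₗ[ℚ] V)ˣ)
    (hg : ∀ v, (g : V →ₗ[ℚ] V) v = v - (2 : ℚ) • (B v a • a)) :
    (∀ x y : V, B ((g : V →ₗ[ℚ] V) x) ((g : V →ₗ[ℚ] V) y) = B x y) ∧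
    (∀ x ∈ Submodule.span ℤ Δ, (g : V →ₗ[ℚ] V) x ∈ Submodule.span ℤ Δ) ∧
    (∀ x ∈ Submodule.span ℤ Δ, ((g⁻¹ : (V →ₗ[ℚ] V)ˣ) : V →ₗ[ℚ] V) x ∈ Submodule.span ℤ Δ) ∧
    (∀ l : V →ₗ[ℚ] ℚ, (∀ x ∈ Submodule.span ℤ Δ, ∃ z : ℤ, l x = z) →
      ∃ v ∈ Submodule.span ℤ Δ, ∀ x ∈ Submodule.span ℤ Δ,
        l ((g : V →ₗ[ℚ] V) x - x) = 2 * B v x) := by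
  have haa : B a a = 0 := hB.self_eq_zero a
  -- `2 B(x, a) a ∈ ℤΔ` for `x ∈ ℤΔ`
  have h2 : ∀ {x : V}, x ∈ Submodule.span ℤ Δ → (2 : ℚ) • (B x a • a) ∈ Submodule.span ℤ Δ :=
    fun hx => by
      rw [two_smul]
      have h := localTubeSpan_cast_smul_mem_span_int Δ
        (localTubeSpan_exists_int_eq_of_mem_span_int_of_mem_span_int B Δ hint hx ha) ha
      exact Submodule.add_mem _ h h
  refine ⟨fun x y => ?_, fun x hx => ?_, fun x hx => ?_, fun l hl => ?_⟩
  · -- isometry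
    have h1 : B a y = -B y a := (hB.neg_eq y a).symm
    rw [hg x, hg y]
    simp only [map_sub, map_smul, LinearMap.sub_apply, LinearMap.smul_apply, smul_eq_mul, haa, h1]
    ring
  · -- `g` preserves `ℤΔ`
    rw [hg x]
    exact Submodule.sub_mem _ hx (h2 hx)
  · -- `g⁻¹ : v ↦ v + 2 B(v, a) a` preserves `ℤΔ`
    rw [localTubeSpan_sqMove_inv_apply B hB a g hg x]
    exact Submodule.add_mem _ hx (h2 hx)
  · -- Schnell's displayed condition with `v = l(a) a`
    refine ⟨l a • a, localTubeSpan_cast_smul_mem_span_int Δ (hl a ha) ha, fun x _ => ?_⟩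
    have h1 : B a x = -B x a := (hB.neg_eq x a).symm
    rw [hg x, sub_sub_cancel_left]
    simp only [map_neg, map_smul, LinearMap.smul_apply, smul_eq_mul, h1]
    ring

/-- **Pair moves satisfy the four conditions.**  Let `B` be alternating and integral on `Δ`,
`e, f ∈ ℤΔ` with `B(e, f) = 0`, and let the unit `g` of `End V` act as
`E_{e,f}² : v ↦ v + 2 (B(v, e) f + B(v, f) e)`.  Then `g` is an isometry, `g` and
`g⁻¹ : v ↦ v - 2 (B(v, e) f + B(v, f) e)` preserve `ℤΔ`, and
`l (g x - x) = 2 (B(x, e) l(f) + B(x, f) l(e)) = 2 B(v, x)` for `v = -(l(f) e + l(e) f) ∈ ℤΔ` and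
`l` integral on `ℤΔ`. [cite: Schnell2010, §7 Thm. 10] -/
theorem localTubeSpan_sp2Cond_of_pairMove (hB : B.IsAlt)
    (hint : ∀ δ ∈ Δ, ∀ δ' ∈ Δ, ∃ n : ℤ, B δ δ' = n)
    {e f : V} (he : e ∈ Submodule.span ℤ Δ) (hf : f ∈ Submodule.span ℤ Δ) (hef : B e f = 0)
    (g : (V →ₗ[ℚ] V)ˣ)
    (hg : ∀ v, (g : V →ₗ[ℚ] V) v = v + (2 : ℚ) • (B v e • f + B v f • e)) :
    (∀ x y : V, B ((g : V →ₗ[ℚ] V) x) ((g : V →ₗ[ℚ] V) y) = B x y) ∧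
    (∀ x ∈ Submodule.span ℤ Δ, (g : V →ₗ[ℚ] V) x ∈ Submodule.span ℤ Δ) ∧
    (∀ x ∈ Submodule.span ℤ Δ, ((g⁻¹ : (V →ₗ[ℚ] V)ˣ) : V →ₗ[ℚ] V) x ∈ Submodule.span ℤ Δ) ∧
    (∀ l : V →ₗ[ℚ] ℚ, (∀ x ∈ Submodule.span ℤ Δ, ∃ z : ℤ, l x = z) →
      ∃ v ∈ Submodule.span ℤ Δ, ∀ x ∈ Submodule.span ℤ Δ,
        l ((g : V →ₗ[ℚ] V) x - x) = 2 * B v x) := by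
  have hfe : B f e = 0 := by rw [← hB.neg_eq, hef, neg_zero]
  have hee : B e e = 0 := hB.self_eq_zero e
  have hff : B f f = 0 := hB.self_eq_zero f
  -- `2 (B(x, e) f + B(x, f) e) ∈ ℤΔ` for `x ∈ ℤΔ`
  have h2 : ∀ {x : V}, x ∈ Submodule.span ℤ Δ →
      (2 : ℚ) • (B x e • f + B x f • e) ∈ Submodule.span ℤ Δ := fun hx => by
    rw [two_smul]
    have h : B _ e • f + B _ f • e ∈ Submodule.span ℤ Δ := Submodule.add_mem _
      (localTubeSpan_cast_smul_mem_span_int Δ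
        (localTubeSpan_exists_int_eq_of_mem_span_int_of_mem_span_int B Δ hint hx he) hf)
      (localTubeSpan_cast_smul_mem_span_int Δ
        (localTubeSpan_exists_int_eq_of_mem_span_int_of_mem_span_int B Δ hint hx hf) he)
    exact Submodule.add_mem _ h h
  -- the inverse acts as `v ↦ v - 2 (B(v, e) f + B(v, f) e)`
  have hg' : ∀ v, ((g⁻¹ : (V →ₗ[ℚ] V)ˣ) : V →ₗ[ℚ] V) v = v - (2 : ℚ) • (B v e • f + B v f • e) := by
    intro v
    have h1 : (g : V →ₗ[ℚ] V) (v - (2 : ℚ) • (B v e • f + B v f • e)) = v := by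
      rw [hg]
      simp only [map_sub, map_add, map_smul, LinearMap.sub_apply, LinearMap.add_apply,
        LinearMap.smul_apply, smul_eq_mul, hee, hff, hef, hfe, mul_zero, add_zero,
        sub_zero, sub_add_cancel]
    calc ((g⁻¹ : (V →ₗ[ℚ] V)ˣ) : V →ₗ[ℚ] V) v
        = ((g⁻¹ : (V →ₗ[ℚ] V)ˣ) : V →ₗ[ℚ] V)
            ((g : V →ₗ[ℚ] V) (v - (2 : ℚ) • (B v e • f + B v f • e))) := by rw [h1]
      _ = v - (2 : ℚ) • (B v e • f + B v f • e) := localTubeSpan_units_inv_apply_apply g _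
  refine ⟨localTubeSpan_pairMove_isometry B hB hef (g : V →ₗ[ℚ] V) hg, fun x hx => ?_,
    fun x hx => ?_, fun l hl => ?_⟩
  · -- `g` preserves `ℤΔ`
    rw [hg x]
    exact Submodule.add_mem _ hx (h2 hx)
  · -- `g⁻¹` preserves `ℤΔ`
    rw [hg' x]
    exact Submodule.sub_mem _ hx (h2 hx)
  · -- Schnell's displayed condition with `v = -(l(f) e + l(e) f)`
    refine ⟨-(l f • e + l e • f), Submodule.neg_mem _ (Submodule.add_mem _
      (localTubeSpan_cast_smul_mem_span_int Δ (hl f hf) he)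
      (localTubeSpan_cast_smul_mem_span_int Δ (hl e he) hf)), fun x _ => ?_⟩
    have h1 : B e x = -B x e := (hB.neg_eq x e).symm
    have h2 : B f x = -B x f := (hB.neg_eq x f).symm
    rw [hg x, add_sub_cancel_left]
    simp only [map_add, map_smul, map_neg, LinearMap.add_apply, LinearMap.smul_apply,
      LinearMap.neg_apply, smul_eq_mul, h1, h2]
    ring

end Sp2Closure

end Summit.HodgeConjecture.HodgeConjecture.Theorems

end
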